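import Mathlib.MeasureTheory.Measure.HasOuterApproxClosed
import Mathlib.MeasureTheory.Measure.Prod
import Mathlib.Probability.ConditionalProbability
import Mathlib.Analysis.SpecialFunctions.Pow.Real
import Mathlib.Analysis.Normed.MulAction
import Mathlib.Topology.ContinuousMap.Algebra
import Mathlib.Topology.ContinuousMap.SecondCountableSpace
import Mathlib.Topology.MetricSpace.Lipschitz
import Mathlib.Topology.MetricSpace.Polish
import Mathlib.Topology.UniformSpace.HeineCantor
import Literature.Probability.RandomPlanarGeometry.AffineInterp
import Literature.Probability.RandomPlanarGeometry.SAWCount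
import HarnessLib

/-!
# Naturally parametrised rooted curves and the fusion map on their laws

Topic `Literature/Probability/RandomPlanarGeometry`; definition request `FusionMapOnCurveLaws`
(route `SAWDimerizationRG` of `CriticalPhenomena/SAWScalingLimit`, crux `FusionRigidity`).

## Contents (namespace `Literature.Probability.RandomPlanarGeometry`)

* `RootedCurve E` — a **naturally parametrised rooted curve of finite duration**: a duration
  `T ≥ 0` and a continuous `γ : ℝ → E` with `γ t = 0` for `t ≤ 0` (rooted at `0`) and
  `γ t = γ T` for `t ≥ T` (frozen after `T`); i.e. the curve `γ : [0, T] → E`, `γ 0 = 0`, in which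
  the PARAMETRISATION IS DATA (Lawler–Sheffield 2011, §1.2: the limit objects of SAW in its natural
  parametrisation are "continuous curves `γ : [0, t_γ] → ℂ`"). Metric: the larger of `|T₁ - T₂|`
  and `sup_t ‖γ₁ t - γ₂ t‖` (frozen extensions), obtained by the isometric embedding
  `toProd : RootedCurve E → ℝ × (ℝ →ᵇ E)`; Borel σ-algebra. PROVED: uniform continuity of every
  curve, joint continuity of evaluation, `CompleteSpace`, `SecondCountableTopology` (through the
  embedding `toShape` into `ℝ × C(unitInterval, E)`), hence `PolishSpace` and `BorelSpace`.
* operations, all proved continuous (hence measurable): time reversal re-rooted at the new start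
  `reverse` (`t ↦ γ (T - t) - γ T`), concatenation `append` (`c₁` then `c₂` translated to start at
  `c₁ T₁`; duration `T₁ + T₂`), linear images `mapL L` (rotations, reflections: the `D₄` symmetry),
  time–space rescaling `rescale a b : (T, γ) ↦ (a T, t ↦ b • γ (t / a))` and the dilations
  `dilate ν a := rescale a (a ^ ν)` — so that `S_λ` of the request, `(T, γ) ↦ (λ^{1/ν} T, λ γ)`, is
  `dilate ν (λ ^ (1/ν))` (Lawler–Sheffield 2011, §1.2: under `z ↦ r z` natural time is multiplied
  by `r^d`, `d = 1/ν`); the trace after the root `tail γ = γ (0, T]`; two-sided curves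
  `twoSided c₁ c₂ : C(ℝ, E)` (`c₁` run backwards on `t ≤ 0`, `c₂` forwards on `t ≥ 0`) and the
  re-rooting shift `reroot t₀ γ = γ (t₀ + ·) - γ t₀` on `C(ℝ, E)`.
* lattice input: `ofWalk n x`, the piecewise-linear curve through `x 0, …, x n` at unit speed
  (one step per unit time, duration `n`, rooted at `x 0`), and `sawCurve s τ n ω`, the `n`-step
  walk `ω` of `ℤ²` drawn on `s ℤ² ⊆ ℂ` with time `τ` per step (Lawler–Sheffield 2011, §1.2:
  `ω̂ (j ε^d) = ω_j`, linear interpolation); `sawCurveLaw s τ n`, the uniform law on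
  `SAW.Zd.saws 2 n` pushed to `RootedCurve ℂ`.
* the **fusion map on laws** (posited by the route; lattice prototype = dimerization,
  Madras–Slade 1993, §9.3.2, Lemma 9.3.1: two independent uniform SAWs conditioned on mutual
  avoidance concatenate to a uniform SAW; pairs of SAWs meeting only at their common root are the
  `Λ^{*,2}` of Lawler–Schramm–Werner 2004, §3.4.6; continuum analogue: mutually avoiding SLE paths,
  Kozdron–Lawler 2007): `nearlyDisjoint ε` = the event `D_ε = {γ₁(0,T₁] ∩ γ₂(0,T₂] ⊆ B(0, ε)}`;
  `fusePair (γ₁, γ₂) = append (reverse γ₁) γ₂` (the two-sided curve re-rooted at its start, cf.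
  `fusePair_apply_eq_reroot_twoSided`); `pairFusion ε P Q = fusePair_* ((P ⊗ Q) ∣ D_ε)`;
  the uneven pre-limit map `fusionEps ν t ε P = pairFusion ε ((dilate ν t)_* P) ((dilate ν (1-t))_* P)`
  (`t ∈ (0,1)`: durations `t T` and `(1-t) T` fuse to `T`) and the even one
  `evenFusionEps ν ε P = (dilate ν 2⁻¹)_* (pairFusion ε P P)`; the limit predicate
  `HasFusionLaw ν t P Q` ("`Ψ_{ν,t}(P)` is defined and equals `Q`": `D_ε` has positive mass for
  every `ε > 0` and `fusionEps ν t ε P → Q` weakly as `ε → 0⁺`) and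
  `IsFusionFixedPoint ν P :⟺ ∀ t ∈ (0,1), HasFusionLaw ν t P P`.
  PROVED: `HasFusionLaw.unique` (the limit is unique), `HasFusionLaw.isProbabilityMeasure`,
  `isProbabilityMeasure_pairFusion`.

## Design notes

* The frozen two-sided extension makes the operations pointwise formulas without case splits:
  `append c₁ c₂ = t ↦ c₁ t + c₂ (t - T₁)` and `reverse c = t ↦ c (T - t) - c T`.
* `rescale a b` with `a ≤ 0` is the trivial curve (junk, documented); `dilate ν a` is meant for
  `a > 0`.
* The metric is the `d_∞` distance of stopped paths, `|T₁ - T₂| ∨ ‖γ̂₁ - γ̂₂‖_∞`; on curves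
  parametrised from time `0` it defines the same convergent sequences as the reparametrisation
  metric `ρ` of Lawler–Viklund (inf over increasing homeomorphisms; not needed and not proved here).
* Not here (left to the route): the lattice dictionary `pairFusion ε (sawCurveLaw …) = sawCurveLaw …`
  for `ε` below the mesh (it is the route's support item `DimerizationBijection` plus trace
  geometry of lattice polylines), the existence of any fusion law, whole-plane SLE.

## References

* N. Madras, G. Slade, *The Self-Avoiding Walk*, Birkhäuser 1993, §9.3.2, Lemma 9.3.1 (p. 309).
* G. F. Lawler, O. Schramm, W. Werner, *On the scaling limit of planar self-avoiding walk*,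
  Proc. Sympos. Pure Math. 72 (2004), §3.4.6 (pairs `Λ_k^{*,2}` of SAWs with `ω¹ ∩ ω² = {0}`).
* G. F. Lawler, S. Sheffield, *A natural parametrization for the Schramm–Loewner evolution*,
  Ann. Probab. 39 (2011), §1.2 (curves `γ : [0,t_γ] → ℂ`, `ω̂(jε^d) = ω_j`, time scaling `r^d`).
* M. Kozdron, G. F. Lawler, *The configurational measure on mutually avoiding SLE paths* (2007).
-/

noncomputable section

open Set Filter Topology MeasureTheory ProbabilityTheory
open scoped BoundedContinuousFunction NNReal ENNReal unitInterval

namespace Literature.Probability.RandomPlanarGeometry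

/-- A **naturally parametrised rooted curve of finite duration** in `E`: a duration `dur = T ≥ 0`
and a continuous path `ℝ → E`, equal to `0` for `t ≤ 0` (the curve starts at the root `0` at time
`0`) and frozen (`= γ T`) for `t ≥ T`. This is the curve `γ : [0, T] → E`, `γ 0 = 0`, together
with its parametrisation (Lawler–Sheffield 2011, §1.2: the scaling limit of SAW in the natural
parametrisation lives on "continuous curves `γ : [0, t_γ] → ℂ`"). [cite: LawlerSheffield2011, §1.2] -/
@[ext]
structure RootedCurve (E : Type*) [NormedAddCommGroup E] where
  /-- the duration `T ≥ 0` of the curve -/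
  dur : ℝ
  /-- the path, extended to all real times by freezing -/
  toFun : ℝ → E
  /-- the duration is non-negative -/
  dur_nonneg : 0 ≤ dur
  /-- the path is continuous -/
  continuous_toFun : Continuous toFun
  /-- rooted at `0` and frozen before time `0` -/
  apply_of_nonpos : ∀ t ≤ 0, toFun t = 0
  /-- frozen after time `dur` -/
  apply_of_dur_le : ∀ t, dur ≤ t → toFun t = toFun dur

namespace RootedCurve

section Group

variable {E : Type*} [NormedAddCommGroup E]

/-- A rooted curve is used as the function `ℝ → E` (its frozen path). [folklore] -/
instance : CoeFun (RootedCurve E) fun _ => ℝ → E := ⟨RootedCurve.toFun⟩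

/-- The path of a rooted curve is continuous. [folklore] -/
protected theorem continuous (c : RootedCurve E) : Continuous c := c.continuous_toFun

/-- A rooted curve starts at the root `0`. [folklore] -/
@[simp] theorem apply_zero (c : RootedCurve E) : c 0 = 0 := c.apply_of_nonpos 0 le_rfl

/-- The frozen extension factors through the clamp `projIcc 0 T`. [folklore] -/
theorem apply_projIcc (c : RootedCurve E) (t : ℝ) :
    c (projIcc 0 c.dur c.dur_nonneg t) = c t := by
  rcases le_total t 0 with ht | ht
  · rw [projIcc_of_le_left _ ht, c.apply_of_nonpos t ht]
    exact c.apply_zero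
  rcases le_total c.dur t with hT | hT
  · rw [projIcc_of_right_le _ hT]
    exact (c.apply_of_dur_le t hT).symm
  · rw [projIcc_of_mem _ ⟨ht, hT⟩]

/-- The trace of a rooted curve is the image of `[0, T]`. [folklore] -/
theorem range_eq_image (c : RootedCurve E) : range c = c '' Icc 0 c.dur := by
  refine Subset.antisymm ?_ (image_subset_range _ _)
  rintro _ ⟨t, rfl⟩
  exact ⟨projIcc 0 c.dur c.dur_nonneg t, (projIcc 0 c.dur c.dur_nonneg t).2, c.apply_projIcc t⟩

/-- The trace of a rooted curve is compact. [folklore] -/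
theorem isCompact_range (c : RootedCurve E) : IsCompact (range c) := by
  rw [range_eq_image]
  exact isCompact_Icc.image c.continuous

/-- A rooted curve is uniformly continuous (Heine–Cantor on `[0, T]` and the `1`-Lipschitz clamp).
[folklore] -/
protected theorem uniformContinuous (c : RootedCurve E) : UniformContinuous c := by
  have h1 : UniformContinuous fun x : Icc (0 : ℝ) c.dur => c x :=
    CompactSpace.uniformContinuous_of_continuous (c.continuous.comp continuous_subtype_val)
  have h2 := h1.comp (LipschitzWith.projIcc c.dur_nonneg).uniformContinuous
  have : (c : ℝ → E) = (fun x : Icc (0 : ℝ) c.dur => c x) ∘ projIcc 0 c.dur c.dur_nonneg := by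
    ext t
    simp [apply_projIcc]
  rw [this]
  exact h2

/-- The frozen path as a bounded continuous function on `ℝ`. [folklore] -/
def toBCF (c : RootedCurve E) : ℝ →ᵇ E where
  toFun := c
  continuous_toFun := c.continuous
  map_bounded' := by
    obtain ⟨C, hC⟩ := Metric.isBounded_iff.1 c.isCompact_range.isBounded
    exact ⟨C, fun x y => hC (mem_range_self x) (mem_range_self y)⟩

/-- `toBCF` is the path. [folklore] -/
@[simp] theorem toBCF_apply (c : RootedCurve E) (t : ℝ) : c.toBCF t = c t := rfl

/-- The embedding `(T, γ̂)` into `ℝ × (ℝ →ᵇ E)` defining the metric. [folklore] -/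
def toProd (c : RootedCurve E) : ℝ × (ℝ →ᵇ E) := (c.dur, c.toBCF)

/-- A rooted curve is determined by its duration and its frozen path. [folklore] -/
theorem toProd_injective : Function.Injective (toProd : RootedCurve E → ℝ × (ℝ →ᵇ E)) := by
  intro c₁ c₂ h
  obtain ⟨h1, h2⟩ := Prod.ext_iff.1 h
  exact RootedCurve.ext h1 (funext fun t => DFunLike.congr_fun (h2 : c₁.toBCF = c₂.toBCF) t)

/-- The metric of naturally parametrised curves: `dist c₁ c₂ = |T₁ - T₂| ⊔ sup_t ‖γ̂₁ t - γ̂₂ t‖`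
(frozen extensions), i.e. the metric induced by `toProd`. [folklore] -/
instance instMetricSpace : MetricSpace (RootedCurve E) :=
  MetricSpace.induced toProd toProd_injective inferInstance

/-- The distance of two rooted curves. [folklore] -/
theorem dist_eq (c₁ c₂ : RootedCurve E) :
    dist c₁ c₂ = max (dist c₁.dur c₂.dur) (dist c₁.toBCF c₂.toBCF) := rfl

/-- `toProd` is an isometry. [folklore] -/
theorem isometry_toProd : Isometry (toProd : RootedCurve E → ℝ × (ℝ →ᵇ E)) := fun _ _ => rfl

/-- `toProd` is continuous. [folklore] -/
theorem continuous_toProd : Continuous (toProd : RootedCurve E → ℝ × (ℝ →ᵇ E)) :=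
  isometry_toProd.continuous

/-- Durations are `1`-Lipschitz. [folklore] -/
theorem dist_dur_le (c₁ c₂ : RootedCurve E) : dist c₁.dur c₂.dur ≤ dist c₁ c₂ := le_max_left _ _

/-- Values at a fixed time are `1`-Lipschitz. [folklore] -/
theorem dist_apply_le (c₁ c₂ : RootedCurve E) (t : ℝ) : dist (c₁ t) (c₂ t) ≤ dist c₁ c₂ :=
  (BoundedContinuousFunction.dist_coe_le_dist (f := c₁.toBCF) (g := c₂.toBCF) t).trans
    (le_max_right _ _)

/-- Bounding the distance of two curves by a bound on durations and a uniform pointwise bound.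
[folklore] -/
theorem dist_le_of {c₁ c₂ : RootedCurve E} {C : ℝ} (hC : 0 ≤ C) (hdur : dist c₁.dur c₂.dur ≤ C)
    (h : ∀ t, dist (c₁ t) (c₂ t) ≤ C) : dist c₁ c₂ ≤ C :=
  max_le hdur ((BoundedContinuousFunction.dist_le hC).2 h)

/-- The duration is a continuous functional. [folklore] -/
theorem continuous_dur : Continuous (dur : RootedCurve E → ℝ) :=
  continuous_fst.comp continuous_toProd

/-- The frozen path is a continuous functional (uniform topology). [folklore] -/
theorem continuous_toBCF : Continuous (toBCF : RootedCurve E → ℝ →ᵇ E) :=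
  continuous_snd.comp continuous_toProd

/-- Evaluation `(γ, t) ↦ γ t` is jointly continuous. [folklore] -/
theorem continuous_eval : Continuous fun p : RootedCurve E × ℝ => p.1 p.2 :=
  (ContinuousEval.continuous_eval (F := ℝ →ᵇ E)).comp
    (continuous_toBCF.prodMap continuous_id)

/-- The Borel σ-algebra of the metric of naturally parametrised curves. [folklore] -/
instance instMeasurableSpace : MeasurableSpace (RootedCurve E) := borel _

/-- The σ-algebra of `RootedCurve E` is the Borel one by definition. [folklore] -/
instance instBorelSpace : BorelSpace (RootedCurve E) := ⟨rfl⟩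

/-! ### Completeness, second countability, Polishness -/

/-- The range of `toProd` is the closed set of pairs `(T, g)` with `T ≥ 0`, `g = 0` on `(-∞, 0]`
and `g` frozen after `T`. [folklore] -/
theorem range_toProd : range (toProd : RootedCurve E → ℝ × (ℝ →ᵇ E)) =
    {p | 0 ≤ p.1} ∩ (⋂ t : ℝ, {p | p.2 (min t 0) = 0}) ∩ ⋂ t : ℝ, {p | p.2 (max t p.1) = p.2 p.1} := by
  ext ⟨T, g⟩
  simp only [mem_range, mem_inter_iff, mem_setOf_eq, mem_iInter]
  constructor
  · rintro ⟨c, hc⟩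
    obtain ⟨rfl, rfl⟩ := Prod.ext_iff.1 hc
    exact ⟨⟨c.dur_nonneg, fun t => c.apply_of_nonpos _ (min_le_right _ _)⟩,
      fun t => c.apply_of_dur_le _ (le_max_right _ _)⟩
  · rintro ⟨⟨hT, h0⟩, h1⟩
    refine ⟨⟨T, g, hT, g.continuous, fun t ht => ?_, fun t ht => ?_⟩, rfl⟩
    · simpa [min_eq_left ht] using h0 t
    · simpa [max_eq_left ht] using h1 t

/-- The range of `toProd` is closed. [folklore] -/
theorem isClosed_range_toProd : IsClosed (range (toProd : RootedCurve E → ℝ × (ℝ →ᵇ E))) := by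
  rw [range_toProd]
  have hev : Continuous fun q : (ℝ × (ℝ →ᵇ E)) × ℝ => q.1.2 q.2 :=
    (ContinuousEval.continuous_eval (F := ℝ →ᵇ E)).comp
      ((continuous_snd.comp continuous_fst).prodMk continuous_snd)
  refine ((isClosed_le continuous_const continuous_fst).inter
    (isClosed_iInter fun t => isClosed_eq ?_ continuous_const)).inter
    (isClosed_iInter fun t => isClosed_eq ?_ ?_)
  · exact hev.comp (continuous_id.prodMk continuous_const)
  · exact hev.comp (continuous_id.prodMk (continuous_const.max continuous_fst))
  · exact hev.comp (continuous_id.prodMk continuous_fst)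

/-- Naturally parametrised curves in a complete space form a complete metric space. [folklore] -/
instance instCompleteSpace [CompleteSpace E] : CompleteSpace (RootedCurve E) :=
  (completeSpace_iff_isComplete_range isometry_toProd.isUniformInducing).2
    isClosed_range_toProd.isComplete

/-- The shape `s ↦ γ (s T)`, `s ∈ [0, 1]`, of a rooted curve. [folklore] -/
def shape (c : RootedCurve E) : C(I, E) where
  toFun s := c ((s : ℝ) * c.dur)
  continuous_toFun := c.continuous.comp (continuous_subtype_val.mul continuous_const)

/-- The shape at parameter `s`. [folklore] -/
@[simp] theorem shape_apply (c : RootedCurve E) (s : I) : c.shape s = c ((s : ℝ) * c.dur) := rfl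

/-- Duration and shape: an embedding into the second-countable space `ℝ × C([0,1], E)` (it is not
an isometry for the sup metric of shapes and its range is not closed). [folklore] -/
def toShape (c : RootedCurve E) : ℝ × C(I, E) := (c.dur, c.shape)

/-- `toShape` is continuous. [folklore] -/
theorem continuous_toShape : Continuous (toShape : RootedCurve E → ℝ × C(I, E)) := by
  refine continuous_dur.prodMk (ContinuousMap.continuous_of_continuous_uncurry _ ?_)
  change Continuous fun p : RootedCurve E × I => p.1 ((p.2 : ℝ) * p.1.dur)
  exact continuous_eval.comp (continuous_fst.prodMk
    ((continuous_subtype_val.comp continuous_snd).mul (continuous_dur.comp continuous_fst)))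

/-- Shape coordinates control the distance: if durations are `δ`-close and shapes are uniformly
`δ`-close, with `δ` below a uniform-continuity modulus of the reference curve for `η`, then the
curves are `(δ + η) ⊔ δ`-close. [folklore] -/
theorem dist_le_of_shape {c c₀ : RootedCurve E} {δ η : ℝ} (hδ : 0 ≤ δ) (hη : 0 ≤ η)
    (hdur : dist c.dur c₀.dur ≤ δ) (hshape : ∀ s : I, dist (c.shape s) (c₀.shape s) ≤ δ)
    (hmod : ∀ a b : ℝ, dist a b ≤ δ → dist (c₀ a) (c₀ b) ≤ η) :
    dist c c₀ ≤ δ + η := by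
  refine dist_le_of (by positivity) (hdur.trans (le_add_of_nonneg_right hη)) fun t => ?_
  rcases le_or_gt t 0 with ht | ht
  · rw [c.apply_of_nonpos t ht, c₀.apply_of_nonpos t ht, dist_self]
    positivity
  have hTT : |c.dur - c₀.dur| ≤ δ := by rwa [← Real.dist_eq]
  rcases le_or_gt t c.dur with htT | htT
  · -- `0 < t ≤ T`: write `t = s T`
    have hT : 0 < c.dur := ht.trans_le htT
    set s : I := ⟨t / c.dur, div_nonneg ht.le hT.le, div_le_one_of_le₀ htT hT.le⟩ with hs
    have hst : (s : ℝ) * c.dur = t := div_mul_cancel₀ t hT.ne'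
    calc dist (c t) (c₀ t) ≤ dist (c t) (c₀ ((s : ℝ) * c₀.dur)) + dist (c₀ ((s : ℝ) * c₀.dur)) (c₀ t) :=
          dist_triangle _ _ _
      _ ≤ δ + η := add_le_add (by simpa [hst] using hshape s) (hmod _ _ ?_)
    rw [Real.dist_eq, ← hst, ← mul_sub, abs_mul, abs_of_nonneg s.2.1, ← abs_neg, neg_sub]
    exact (mul_le_of_le_one_left (abs_nonneg _) s.2.2).trans hTT
  · -- `t > T`: `c t = c T`
    rw [c.apply_of_dur_le t htT.le]
    have h1 : dist (c c.dur) (c₀ c₀.dur) ≤ δ := by simpa using hshape 1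
    calc dist (c c.dur) (c₀ t) ≤ dist (c c.dur) (c₀ c₀.dur) + dist (c₀ c₀.dur) (c₀ t) :=
          dist_triangle _ _ _
      _ ≤ δ + η := add_le_add h1 ?_
    rcases le_or_gt c₀.dur t with h0 | h0
    · rw [c₀.apply_of_dur_le t h0, dist_self]
      exact hη
    · refine hmod _ _ ?_
      rw [Real.dist_eq, abs_of_nonneg (by linarith)]
      rw [abs_of_nonpos (by linarith)] at hTT
      linarith

/-- `toShape` induces the topology of `RootedCurve E`. [folklore] -/
theorem isInducing_toShape : IsInducing (toShape : RootedCurve E → ℝ × C(I, E)) := by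
  refine isInducing_iff_nhds.2 fun c₀ => le_antisymm (tendsto_iff_comap.1
    continuous_toShape.continuousAt) ((Metric.nhds_basis_ball.ge_iff).2 fun ε hε => ?_)
  obtain ⟨δ₀, hδ₀, hmod⟩ := Metric.uniformContinuous_iff.1 c₀.uniformContinuous (ε / 4)
    (by positivity)
  set δ : ℝ := min (δ₀ / 2) (ε / 4) with hδ
  have hδpos : 0 < δ := lt_min (by positivity) (by positivity)
  refine mem_comap.2 ⟨Metric.ball (toShape c₀) δ, Metric.ball_mem_nhds _ hδpos, fun c hc => ?_⟩
  rw [mem_preimage, Metric.mem_ball, Prod.dist_eq, max_lt_iff] at hc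
  rw [Metric.mem_ball]
  refine (dist_le_of_shape hδpos.le (by positivity : (0 : ℝ) ≤ ε / 4) hc.1.le (fun s => ?_)
    (fun a b hab => (hmod (hab.trans_lt ?_)).le)).trans_lt ?_
  · exact (ContinuousMap.dist_apply_le_dist s).trans hc.2.le
  · exact (min_le_left _ _).trans_lt (half_lt_self hδ₀)
  · linarith [min_le_right (δ₀ / 2) (ε / 4)]

/-- Naturally parametrised curves in a second-countable space form a second-countable space.
[folklore] -/
instance instSecondCountableTopology [SecondCountableTopology E] :
    SecondCountableTopology (RootedCurve E) :=
  isInducing_toShape.secondCountableTopology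

/-- Naturally parametrised curves in a separable complete space form a Polish space. [folklore] -/
instance instPolishSpace [CompleteSpace E] [SecondCountableTopology E] :
    PolishSpace (RootedCurve E) := by
  constructor

/-! ### Operations on rooted curves -/

/-- The trivial curve: duration `0`, sitting at the root. [folklore] -/
def nil : RootedCurve E where
  dur := 0
  toFun _ := 0
  dur_nonneg := le_rfl
  continuous_toFun := continuous_const
  apply_of_nonpos _ _ := rfl
  apply_of_dur_le _ _ := rfl

/-- The trivial curve inhabits `RootedCurve E`. [folklore] -/
instance : Inhabited (RootedCurve E) := ⟨nil⟩

/-- The trivial curve has duration `0`. [folklore] -/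
@[simp] theorem nil_dur : (nil : RootedCurve E).dur = 0 := rfl

/-- The trivial curve sits at the root. [folklore] -/
@[simp] theorem nil_apply (t : ℝ) : (nil : RootedCurve E) t = 0 := rfl

/-- The trace after the root, `γ (0, T]` (the set entering the disjointness event `D_ε`; two
curves from a common root always share the root itself). [cite: LawlerSchrammWerner2004SAW, §3.4.6] -/
def tail (c : RootedCurve E) : Set E := c '' Ioc 0 c.dur

/-- **Time reversal, re-rooted**: `γᴿ t = γ (T - t) - γ T`, the curve run backwards from its tip,
translated to start at the root; same duration. [folklore] -/
def reverse (c : RootedCurve E) : RootedCurve E where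
  dur := c.dur
  toFun t := c (c.dur - t) - c c.dur
  dur_nonneg := c.dur_nonneg
  continuous_toFun := (c.continuous.comp (continuous_const.sub continuous_id)).sub continuous_const
  apply_of_nonpos t ht := by
    rw [c.apply_of_dur_le (c.dur - t) (by linarith), sub_self]
  apply_of_dur_le t ht := by
    rw [c.apply_of_nonpos (c.dur - t) (by linarith), sub_self, c.apply_zero]

/-- Reversal keeps the duration. [folklore] -/
@[simp] theorem reverse_dur (c : RootedCurve E) : c.reverse.dur = c.dur := rfl

/-- The reversed curve at time `t`. [folklore] -/
@[simp] theorem reverse_apply (c : RootedCurve E) (t : ℝ) :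
    c.reverse t = c (c.dur - t) - c c.dur := rfl

/-- Time reversal is an involution. [folklore] -/
@[simp] theorem reverse_reverse (c : RootedCurve E) : c.reverse.reverse = c := by
  refine RootedCurve.ext rfl (funext fun t => ?_)
  show (c (c.dur - (c.dur - t)) - c c.dur) - (c (c.dur - c.dur) - c c.dur) = c t
  rw [sub_sub_cancel, sub_self, c.apply_zero]
  abel

/-- **Concatenation**: `c₁` during `[0, T₁]`, then `c₂` translated to start at the tip `c₁ T₁`
during `[T₁, T₁ + T₂]`; thanks to the frozen extensions this is `t ↦ c₁ t + c₂ (t - T₁)`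
(the lattice prototype is `ω ⊕ ω'`, Lawler–Schramm–Werner 2004, §3.4.6; Madras–Slade 1993, §9.3.2).
[cite: MadrasSlade1993, §9.3.2] -/
def append (c₁ c₂ : RootedCurve E) : RootedCurve E where
  dur := c₁.dur + c₂.dur
  toFun t := c₁ t + c₂ (t - c₁.dur)
  dur_nonneg := add_nonneg c₁.dur_nonneg c₂.dur_nonneg
  continuous_toFun := c₁.continuous.add (c₂.continuous.comp (continuous_id.sub continuous_const))
  apply_of_nonpos t ht := by
    rw [c₁.apply_of_nonpos t ht, c₂.apply_of_nonpos _ (by linarith [c₁.dur_nonneg]), add_zero]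
  apply_of_dur_le t ht := by
    rw [c₁.apply_of_dur_le t (by linarith [c₂.dur_nonneg]), c₂.apply_of_dur_le _ (by linarith),
      c₁.apply_of_dur_le (c₁.dur + c₂.dur) (by linarith [c₂.dur_nonneg]), add_sub_cancel_left]

/-- The duration of a concatenation. [folklore] -/
@[simp] theorem append_dur (c₁ c₂ : RootedCurve E) : (c₁.append c₂).dur = c₁.dur + c₂.dur := rfl

/-- The concatenated curve at time `t`. [folklore] -/
@[simp] theorem append_apply (c₁ c₂ : RootedCurve E) (t : ℝ) :
    c₁.append c₂ t = c₁ t + c₂ (t - c₁.dur) := rfl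

/-- Time reversal is continuous. [folklore] -/
theorem continuous_reverse : Continuous (reverse : RootedCurve E → RootedCurve E) := by
  refine Metric.continuous_iff.2 fun c₀ ε hε => ?_
  obtain ⟨δ₀, hδ₀, hmod⟩ := Metric.uniformContinuous_iff.1 c₀.uniformContinuous (ε / 8)
    (by positivity)
  refine ⟨min δ₀ (ε / 8), lt_min hδ₀ (by positivity), fun c hc => ?_⟩
  have hcδ : dist c c₀ < δ₀ := hc.trans_le (min_le_left _ _)
  have hcε : dist c c₀ < ε / 8 := hc.trans_le (min_le_right _ _)
  have hdur : dist c.dur c₀.dur < δ₀ := (dist_dur_le c c₀).trans_lt hcδ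
  refine (dist_le_of (by positivity : (0 : ℝ) ≤ ε / 2) ?_ fun t => ?_).trans_lt (half_lt_self hε)
  · exact ((dist_dur_le c c₀).trans hcε.le).trans (by linarith)
  simp only [reverse_apply]
  refine (dist_sub_sub_le _ _ _ _).trans ?_
  have h1 : dist (c (c.dur - t)) (c₀ (c₀.dur - t)) ≤ ε / 8 + ε / 8 :=
    (dist_triangle _ (c₀ (c.dur - t)) _).trans (add_le_add ((dist_apply_le c c₀ _).trans hcε.le)
      (hmod (by rwa [Real.dist_eq, sub_sub_sub_cancel_right, ← Real.dist_eq])).le)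
  have h2 : dist (c c.dur) (c₀ c₀.dur) ≤ ε / 8 + ε / 8 :=
    (dist_triangle _ (c₀ c.dur) _).trans
      (add_le_add ((dist_apply_le c c₀ _).trans hcε.le) (hmod hdur).le)
  linarith

/-- Concatenation is jointly continuous. [folklore] -/
theorem continuous_append : Continuous fun p : RootedCurve E × RootedCurve E => p.1.append p.2 := by
  refine Metric.continuous_iff.2 fun p₀ ε hε => ?_
  obtain ⟨δ₀, hδ₀, hmod⟩ := Metric.uniformContinuous_iff.1 p₀.2.uniformContinuous (ε / 8)
    (by positivity)
  refine ⟨min δ₀ (ε / 8), lt_min hδ₀ (by positivity), fun p hp => ?_⟩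
  have h₁ : dist p.1 p₀.1 < min δ₀ (ε / 8) := (le_max_left _ _ : dist p.1 p₀.1 ≤ dist p p₀).trans_lt hp
  have h₂ : dist p.2 p₀.2 < min δ₀ (ε / 8) := (le_max_right _ _ : dist p.2 p₀.2 ≤ dist p p₀).trans_lt hp
  have h₁ε : dist p.1 p₀.1 < ε / 8 := h₁.trans_le (min_le_right _ _)
  have h₂ε : dist p.2 p₀.2 < ε / 8 := h₂.trans_le (min_le_right _ _)
  have hdur : dist p.1.dur p₀.1.dur < δ₀ := (dist_dur_le _ _).trans_lt (h₁.trans_le (min_le_left _ _))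
  refine (dist_le_of (by positivity : (0 : ℝ) ≤ ε / 2) ?_ fun t => ?_).trans_lt (half_lt_self hε)
  · simp only [append_dur]
    refine (dist_add_add_le _ _ _ _).trans ?_
    linarith [dist_dur_le p.1 p₀.1, dist_dur_le p.2 p₀.2]
  simp only [append_apply]
  refine (dist_add_add_le _ _ _ _).trans ?_
  have h3 : dist (p.2 (t - p.1.dur)) (p₀.2 (t - p₀.1.dur)) ≤ ε / 8 + ε / 8 :=
    (dist_triangle _ (p₀.2 (t - p.1.dur)) _).trans (add_le_add ((dist_apply_le _ _ _).trans h₂ε.le)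
      (hmod (by rwa [Real.dist_eq, sub_sub_sub_cancel_left, ← Real.dist_eq, dist_comm])).le)
  linarith [dist_apply_le p.1 p₀.1 t]

/-- Reversal is Borel measurable. [folklore] -/
theorem measurable_reverse : Measurable (reverse : RootedCurve E → RootedCurve E) :=
  continuous_reverse.measurable

/-! ### Two-sided curves and re-rooting -/

/-- The **two-sided curve** of a pair: `c₁` run backwards on `t ≤ 0` and `c₂` forwards on
`t ≥ 0`, a continuous `ℝ → E` through the root at time `0`, frozen outside `[-T₁, T₂]`
(two SAWs from a common root, Lawler–Schramm–Werner 2004, §3.4.6). [cite: LawlerSchrammWerner2004SAW, §3.4.6] -/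
def twoSided (c₁ c₂ : RootedCurve E) : C(ℝ, E) where
  toFun t := c₁ (-t) + c₂ t
  continuous_toFun := (c₁.continuous.comp continuous_neg).add c₂.continuous

/-- The two-sided curve at time `t`. [cite: LawlerSchrammWerner2004SAW, §3.4.6] -/
@[simp] theorem twoSided_apply (c₁ c₂ : RootedCurve E) (t : ℝ) :
    twoSided c₁ c₂ t = c₁ (-t) + c₂ t := rfl

/-- **Re-rooting** (translation in time and space) of a two-sided parametrised curve:
`reroot t₀ γ = γ (t₀ + ·) - γ t₀`. [folklore] -/
def reroot (t₀ : ℝ) (γ : C(ℝ, E)) : C(ℝ, E) where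
  toFun t := γ (t₀ + t) - γ t₀
  continuous_toFun := (γ.continuous.comp (continuous_const.add continuous_id)).sub continuous_const

/-- The re-rooted curve at time `t`. [folklore] -/
@[simp] theorem reroot_apply (t₀ : ℝ) (γ : C(ℝ, E)) (t : ℝ) : reroot t₀ γ t = γ (t₀ + t) - γ t₀ :=
  rfl

/-- Re-rooting is a flow: `reroot s ∘ reroot t₀ = reroot (t₀ + s)`. [folklore] -/
theorem reroot_reroot (s t₀ : ℝ) (γ : C(ℝ, E)) : reroot s (reroot t₀ γ) = reroot (t₀ + s) γ := by
  ext t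
  simp only [reroot_apply]
  rw [add_assoc]
  abel

/-- Re-rooting is continuous for the topology of locally uniform convergence. [folklore] -/
theorem continuous_reroot (t₀ : ℝ) : Continuous (reroot t₀ : C(ℝ, E) → C(ℝ, E)) := by
  refine ContinuousMap.continuous_of_continuous_uncurry _ ?_
  change Continuous fun p : C(ℝ, E) × ℝ => p.1 (t₀ + p.2) - p.1 t₀
  fun_prop

/-- The pair `(c₁, c₂) ↦ twoSided c₁ c₂` is continuous into `C(ℝ, E)`. [cite: LawlerSchrammWerner2004SAW, §3.4.6] -/
theorem continuous_twoSided : Continuous fun p : RootedCurve E × RootedCurve E => twoSided p.1 p.2 := by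
  refine ContinuousMap.continuous_of_continuous_uncurry _ ?_
  change Continuous fun q : (RootedCurve E × RootedCurve E) × ℝ => q.1.1 (-q.2) + q.1.2 q.2
  exact (continuous_eval.comp ((continuous_fst.comp continuous_fst).prodMk continuous_snd.neg)).add
    (continuous_eval.comp ((continuous_snd.comp continuous_fst).prodMk continuous_snd))

/-! ### Fusing a pair; the disjointness event -/

/-- **Fusing a pair**: the reversed first curve followed by the second, `append (reverse c₁) c₂` —
the two-sided curve of the pair re-rooted at its starting point `c₁ T₁`, a rooted curve of duration
`T₁ + T₂` (see `fusePair_apply_eq_reroot_twoSided`). Lattice prototype: concatenating two SAWs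
(Madras–Slade 1993, §9.3.2). [cite: MadrasSlade1993, §9.3.2] -/
def fusePair (p : RootedCurve E × RootedCurve E) : RootedCurve E := p.1.reverse.append p.2

/-- The duration of a fused pair. [cite: MadrasSlade1993, §9.3.2] -/
@[simp] theorem fusePair_dur (p : RootedCurve E × RootedCurve E) :
    (fusePair p).dur = p.1.dur + p.2.dur := rfl

/-- The fused pair is the two-sided curve re-rooted at its start `-T₁`:
`fusePair (c₁, c₂) t = reroot (-T₁) (twoSided c₁ c₂) t`. [cite: LawlerSchrammWerner2004SAW, §3.4.6] -/
theorem fusePair_apply_eq_reroot_twoSided (c₁ c₂ : RootedCurve E) (t : ℝ) :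
    fusePair (c₁, c₂) t = reroot (-c₁.dur) (twoSided c₁ c₂) t := by
  simp only [fusePair, append_apply, reverse_apply, reverse_dur, reroot_apply, twoSided_apply,
    neg_add_rev, neg_neg, add_zero, c₂.apply_of_nonpos (-c₁.dur) (neg_nonpos.2 c₁.dur_nonneg)]
  abel_nf

/-- Fusing is continuous. [cite: MadrasSlade1993, §9.3.2] -/
theorem continuous_fusePair : Continuous (fusePair : RootedCurve E × RootedCurve E → RootedCurve E) :=
  continuous_append.comp (continuous_reverse.prodMap continuous_id)

/-- Fusing is Borel measurable (for the product σ-algebra, `E` second countable). [cite: MadrasSlade1993, §9.3.2] -/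
theorem measurable_fusePair [SecondCountableTopology E] :
    Measurable (fusePair : RootedCurve E × RootedCurve E → RootedCurve E) :=
  continuous_fusePair.measurable

/-- The **`ε`-regularised disjointness event** `D_ε`: the two traces after the common root meet
only inside the ball `B(0, ε)`, `γ₁ (0, T₁] ∩ γ₂ (0, T₂] ⊆ B(0, ε)`. For lattice walks at mesh
`> ε` this is mutual avoidance except at the root, the pairs `Λ^{*,2}` (`ω¹ ∩ ω² = {0}`) of
Lawler–Schramm–Werner 2004, §3.4.6. [cite: LawlerSchrammWerner2004SAW, §3.4.6] -/
def nearlyDisjoint (ε : ℝ) : Set (RootedCurve E × RootedCurve E) :=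
  {p | p.1.tail ∩ p.2.tail ⊆ Metric.ball 0 ε}

/-- `D_ε` increases with `ε`. [cite: LawlerSchrammWerner2004SAW, §3.4.6] -/
theorem nearlyDisjoint_mono {ε ε' : ℝ} (h : ε ≤ ε') :
    (nearlyDisjoint ε : Set (RootedCurve E × RootedCurve E)) ⊆ nearlyDisjoint ε' :=
  fun _ hp => hp.trans (Metric.ball_subset_ball h)

/-- The trivial curve has empty tail. [folklore] -/
@[simp] theorem tail_nil : (nil : RootedCurve E).tail = ∅ := by
  simp [tail]

/-- A pair of trivial curves is `ε`-nearly disjoint. [folklore] -/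
theorem nil_mem_nearlyDisjoint (ε : ℝ) :
    ((nil : RootedCurve E), (nil : RootedCurve E)) ∈ nearlyDisjoint ε := by
  simp [nearlyDisjoint]

/-- The complement of `D_ε` (`ε > 0`) is the projection, along the compact square of shape
parameters `(σ, τ) ∈ [0,1]²`, of the closed set `{γ₁ (σ T₁) = γ₂ (τ T₂), ‖γ₁ (σ T₁)‖ ≥ ε}`.
[folklore] -/
theorem compl_nearlyDisjoint_eq_image {ε : ℝ} (hε : 0 < ε) :
    (nearlyDisjoint ε : Set (RootedCurve E × RootedCurve E))ᶜ =
      Prod.fst '' {q : (RootedCurve E × RootedCurve E) × (I × I) |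
        q.1.1 ((q.2.1 : ℝ) * q.1.1.dur) = q.1.2 ((q.2.2 : ℝ) * q.1.2.dur) ∧
          ε ≤ ‖q.1.1 ((q.2.1 : ℝ) * q.1.1.dur)‖} := by
  ext p
  simp only [mem_compl_iff, nearlyDisjoint, mem_setOf_eq, not_subset, mem_image, mem_inter_iff,
    Metric.mem_ball, dist_zero_right, not_lt]
  constructor
  · rintro ⟨x, ⟨⟨s, hs, rfl⟩, ⟨t, ht, hts⟩⟩, hx⟩
    have hT₁ : 0 < p.1.dur := hs.1.trans_le hs.2
    have hT₂ : 0 < p.2.dur := ht.1.trans_le ht.2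
    refine ⟨(p, ⟨s / p.1.dur, div_nonneg hs.1.le hT₁.le, div_le_one_of_le₀ hs.2 hT₁.le⟩,
      ⟨t / p.2.dur, div_nonneg ht.1.le hT₂.le, div_le_one_of_le₀ ht.2 hT₂.le⟩), ⟨?_, ?_⟩, rfl⟩
    · simp only [div_mul_cancel₀ _ hT₁.ne', div_mul_cancel₀ _ hT₂.ne']
      exact hts.symm
    · simpa only [div_mul_cancel₀ _ hT₁.ne'] using hx
  · rintro ⟨⟨p', u, v⟩, ⟨hEq, hε'⟩, rfl⟩
    simp only at hEq hε' ⊢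
    have hx0 : p'.1 ((u : ℝ) * p'.1.dur) ≠ 0 := fun h => by
      rw [h, norm_zero] at hε'
      exact absurd hε' (not_le.2 hε)
    refine ⟨p'.1 ((u : ℝ) * p'.1.dur), ⟨⟨(u : ℝ) * p'.1.dur, ⟨?_, ?_⟩, rfl⟩,
      ⟨(v : ℝ) * p'.2.dur, ⟨?_, ?_⟩, hEq.symm⟩⟩, hε'⟩
    · refine lt_of_le_of_ne (mul_nonneg u.2.1 p'.1.dur_nonneg) fun h => hx0 ?_
      rw [← h, p'.1.apply_zero]
    · exact mul_le_of_le_one_left p'.1.dur_nonneg u.2.2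
    · refine lt_of_le_of_ne (mul_nonneg v.2.1 p'.2.dur_nonneg) fun h => hx0 ?_
      rw [hEq, ← h, p'.2.apply_zero]
    · exact mul_le_of_le_one_left p'.2.dur_nonneg v.2.2

/-- For `ε > 0` the event `D_ε` is open. [folklore] -/
theorem isOpen_nearlyDisjoint {ε : ℝ} (hε : 0 < ε) :
    IsOpen (nearlyDisjoint ε : Set (RootedCurve E × RootedCurve E)) := by
  rw [← isClosed_compl_iff, compl_nearlyDisjoint_eq_image hε]
  refine isClosedMap_fst_of_compactSpace _ ?_
  have h1 : Continuous fun q : (RootedCurve E × RootedCurve E) × (I × I) =>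
      q.1.1 ((q.2.1 : ℝ) * q.1.1.dur) :=
    continuous_eval.comp ((continuous_fst.comp continuous_fst).prodMk
      ((continuous_subtype_val.comp (continuous_fst.comp continuous_snd)).mul
        (continuous_dur.comp (continuous_fst.comp continuous_fst))))
  have h2 : Continuous fun q : (RootedCurve E × RootedCurve E) × (I × I) =>
      q.1.2 ((q.2.2 : ℝ) * q.1.2.dur) :=
    continuous_eval.comp ((continuous_snd.comp continuous_fst).prodMk
      ((continuous_subtype_val.comp (continuous_snd.comp continuous_snd)).mul
        (continuous_dur.comp (continuous_snd.comp continuous_fst))))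
  exact (isClosed_eq h1 h2).inter (isClosed_le continuous_const h1.norm)

/-- For `ε > 0` the event `D_ε` is measurable for the product σ-algebra (`E` second countable).
[folklore] -/
theorem measurableSet_nearlyDisjoint [SecondCountableTopology E] {ε : ℝ} (hε : 0 < ε) :
    MeasurableSet (nearlyDisjoint ε : Set (RootedCurve E × RootedCurve E)) :=
  (isOpen_nearlyDisjoint hε).measurableSet

/-- Fusing two trivial curves gives the trivial curve. [folklore] -/
@[simp] theorem fusePair_nil : fusePair ((nil : RootedCurve E), (nil : RootedCurve E)) = nil := by
  refine RootedCurve.ext (show (0 : ℝ) + 0 = 0 from add_zero 0) (funext fun t => ?_)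
  show ((nil : RootedCurve E) (0 - t) - (nil : RootedCurve E) 0) + (nil : RootedCurve E) (t - 0) = 0
  simp

/-- **Fusion of two laws with `ε`-regularised conditioning**: sample `(γ₁, γ₂) ~ P ⊗ Q`, condition
on `D_ε = nearlyDisjoint ε`, and push forward by `fusePair`. (At the lattice level, `ε` below the
mesh, `P = U_M`, `Q = U_N`: the dimerization identity of Madras–Slade 1993, Lemma 9.3.1, up to the
reversal of the first walk.) [cite: MadrasSlade1993, §9.3.2 Lemma 9.3.1] -/
def pairFusion (ε : ℝ) (P Q : Measure (RootedCurve E)) : Measure (RootedCurve E) :=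
  ((P.prod Q)[|nearlyDisjoint ε]).map fusePair

/-- The `ε`-fusion of two probability laws is a probability law as soon as `D_ε` has positive
mass. [cite: MadrasSlade1993, §9.3.2] -/
theorem isProbabilityMeasure_pairFusion [SecondCountableTopology E] {ε : ℝ}
    {P Q : Measure (RootedCurve E)} [IsProbabilityMeasure P] [IsProbabilityMeasure Q]
    (h : (P.prod Q) (nearlyDisjoint ε) ≠ 0) : IsProbabilityMeasure (pairFusion ε P Q) := by
  haveI := cond_isProbabilityMeasure (μ := P.prod Q) h
  exact Measure.isProbabilityMeasure_map measurable_fusePair.aemeasurable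

/-- The `ε`-fusion of two Dirac masses at the trivial curve is the Dirac mass at the trivial
curve (the definitions compute; degenerate case). [folklore] -/
theorem pairFusion_dirac_nil [SecondCountableTopology E] (ε : ℝ) :
    pairFusion ε (Measure.dirac (nil : RootedCurve E)) (Measure.dirac nil) = Measure.dirac nil := by
  have hmem := nil_mem_nearlyDisjoint (E := E) ε
  rw [pairFusion, Measure.dirac_prod_dirac, ProbabilityTheory.cond,
    Measure.dirac_apply_of_mem hmem, inv_one, one_smul, Measure.restrict_eq_self_of_ae_mem,
    Measure.map_dirac' measurable_fusePair, fusePair_nil]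
  rw [ae_dirac_eq]
  exact hmem

end Group

section Space

variable {E F : Type*} [NormedAddCommGroup E] [NormedSpace ℝ E] [NormedAddCommGroup F]
  [NormedSpace ℝ F]

/-- The image of a rooted curve under a continuous linear map (rotations and reflections of the
plane act this way; the duration is unchanged). [folklore] -/
def mapL (L : E →L[ℝ] F) (c : RootedCurve E) : RootedCurve F where
  dur := c.dur
  toFun t := L (c t)
  dur_nonneg := c.dur_nonneg
  continuous_toFun := L.continuous.comp c.continuous
  apply_of_nonpos t ht := by rw [c.apply_of_nonpos t ht, map_zero]
  apply_of_dur_le t ht := by rw [c.apply_of_dur_le t ht]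

/-- `mapL` keeps the duration. [folklore] -/
@[simp] theorem mapL_dur (L : E →L[ℝ] F) (c : RootedCurve E) : (c.mapL L).dur = c.dur := rfl

/-- `mapL` acts pointwise. [folklore] -/
@[simp] theorem mapL_apply (L : E →L[ℝ] F) (c : RootedCurve E) (t : ℝ) : c.mapL L t = L (c t) :=
  rfl

/-- `mapL L` is Lipschitz with constant `‖L‖ ⊔ 1`, in particular continuous. [folklore] -/
theorem continuous_mapL (L : E →L[ℝ] F) : Continuous (mapL L : RootedCurve E → RootedCurve F) := by
  refine Metric.continuous_iff.2 fun c₀ ε hε => ?_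
  refine ⟨ε / (‖L‖ + 1), by positivity, fun c hc => ?_⟩
  have hK : 0 < ‖L‖ + 1 := by positivity
  rw [lt_div_iff₀ hK] at hc
  refine (dist_le_of (by positivity : (0 : ℝ) ≤ dist c c₀ * (‖L‖ + 1)) ?_ fun t => ?_).trans_lt hc
  · simpa using (dist_dur_le c c₀).trans (le_mul_of_one_le_right dist_nonneg (by linarith [norm_nonneg L]))
  · simp only [mapL_apply, dist_eq_norm, ← map_sub]
    refine (L.le_opNorm _).trans ?_
    rw [mul_comm, ← dist_eq_norm]
    exact mul_le_mul (dist_apply_le c c₀ t) (by linarith) (norm_nonneg _) dist_nonneg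

/-- Linear images commute with time reversal. [folklore] -/
theorem mapL_reverse (L : E →L[ℝ] F) (c : RootedCurve E) :
    c.reverse.mapL L = (c.mapL L).reverse := by
  refine RootedCurve.ext rfl (funext fun t => ?_)
  show L (c (c.dur - t) - c c.dur) = L (c (c.dur - t)) - L (c c.dur)
  rw [map_sub]

/-- Linear images commute with concatenation. [folklore] -/
theorem mapL_append (L : E →L[ℝ] F) (c₁ c₂ : RootedCurve E) :
    (c₁.append c₂).mapL L = (c₁.mapL L).append (c₂.mapL L) := by
  refine RootedCurve.ext rfl (funext fun t => ?_)
  show L (c₁ t + c₂ (t - c₁.dur)) = L (c₁ t) + L (c₂ (t - c₁.dur))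
  rw [map_add]

/-- Linear images commute with fusing (rotations and reflections act on fused pairs
diagonally). [folklore] -/
theorem mapL_fusePair (L : E →L[ℝ] F) (p : RootedCurve E × RootedCurve E) :
    (fusePair p).mapL L = fusePair (p.1.mapL L, p.2.mapL L) := by
  simp only [fusePair, mapL_append, mapL_reverse]

/-- **Time–space rescaling**: `rescale a b (T, γ) = (a T, t ↦ b • γ (t / a))` for a time factor
`a > 0` and a space factor `b`; for `a ≤ 0` it is the trivial curve (junk value). [folklore] -/
def rescale (a b : ℝ) (c : RootedCurve E) : RootedCurve E where
  dur := max a 0 * c.dur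
  toFun t := b • c (t / max a 0)
  dur_nonneg := mul_nonneg (le_max_right _ _) c.dur_nonneg
  continuous_toFun := (c.continuous.comp (continuous_id.div_const _)).const_smul b
  apply_of_nonpos t ht := by
    rw [c.apply_of_nonpos _ (div_nonpos_of_nonpos_of_nonneg ht (le_max_right _ _)), smul_zero]
  apply_of_dur_le t ht := by
    rcases eq_or_lt_of_le (le_max_right a 0) with h0 | hpos
    · simp [← h0]
    · rw [c.apply_of_dur_le (t / max a 0) (by rwa [le_div_iff₀ hpos, mul_comm]),
        mul_div_cancel_left₀ _ hpos.ne']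

/-- The duration of a rescaled curve (`a ≥ 0`). [folklore] -/
theorem rescale_dur {a : ℝ} (ha : 0 ≤ a) (b : ℝ) (c : RootedCurve E) :
    (c.rescale a b).dur = a * c.dur := by
  simp [rescale, max_eq_left ha]

/-- The rescaled curve at time `t` (`a ≥ 0`). [folklore] -/
theorem rescale_apply {a : ℝ} (ha : 0 ≤ a) (b : ℝ) (c : RootedCurve E) (t : ℝ) :
    c.rescale a b t = b • c (t / a) := by
  simp [rescale, max_eq_left ha]

/-- Rescaling is continuous in the curve. [folklore] -/
theorem continuous_rescale (a b : ℝ) : Continuous (rescale a b : RootedCurve E → RootedCurve E) := by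
  refine Metric.continuous_iff.2 fun c₀ ε hε => ?_
  have hK : 0 < max a 0 + ‖b‖ + 1 := by positivity
  refine ⟨ε / (max a 0 + ‖b‖ + 1), by positivity, fun c hc => ?_⟩
  rw [lt_div_iff₀ hK] at hc
  refine (dist_le_of (by positivity : (0 : ℝ) ≤ dist c c₀ * (max a 0 + ‖b‖ + 1)) ?_ fun t => ?_).trans_lt hc
  · change dist (max a 0 * c.dur) (max a 0 * c₀.dur) ≤ _
    rw [dist_eq_norm, ← mul_sub, norm_mul, Real.norm_of_nonneg (le_max_right a 0), ← dist_eq_norm,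
      mul_comm]
    exact mul_le_mul (dist_dur_le c c₀) (by linarith [norm_nonneg b]) (le_max_right a 0) dist_nonneg
  · change dist (b • c (t / max a 0)) (b • c₀ (t / max a 0)) ≤ _
    rw [dist_smul₀, mul_comm]
    exact mul_le_mul (dist_apply_le c c₀ _) (by linarith [le_max_right a 0]) (norm_nonneg b)
      dist_nonneg

/-- **Dilation with exponent `ν`**: time multiplied by `a`, space by `a ^ ν` (`a > 0`). In the
notation of the request, `S_λ : (T, γ) ↦ (λ^{1/ν} T, λ γ)` is `dilate ν (λ ^ (1/ν))`; this is the
scaling rule of the natural parametrisation, time `∝ (space)^d` with `d = 1/ν`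
(Lawler–Sheffield 2011, §1.2 and §2.2). [cite: LawlerSheffield2011, §1.2] -/
def dilate (ν a : ℝ) : RootedCurve E → RootedCurve E := rescale a (a ^ ν)

/-- Dilations are continuous. [cite: LawlerSheffield2011, §1.2] -/
theorem continuous_dilate (ν a : ℝ) : Continuous (dilate ν a : RootedCurve E → RootedCurve E) :=
  continuous_rescale _ _

/-- Dilations are Borel measurable. [cite: LawlerSheffield2011, §1.2] -/
theorem measurable_dilate (ν a : ℝ) : Measurable (dilate ν a : RootedCurve E → RootedCurve E) :=
  (continuous_dilate ν a).measurable

/-- The duration of a dilated curve (`a ≥ 0`). [cite: LawlerSheffield2011, §1.2] -/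
theorem dilate_dur {ν a : ℝ} (ha : 0 ≤ a) (c : RootedCurve E) : (dilate ν a c).dur = a * c.dur :=
  rescale_dur ha _ c

/-- Linear images commute with rescaling. [folklore] -/
theorem mapL_rescale (L : E →L[ℝ] F) (a b : ℝ) (c : RootedCurve E) :
    (c.rescale a b).mapL L = (c.mapL L).rescale a b := by
  refine RootedCurve.ext rfl (funext fun t => ?_)
  show L (b • c (t / max a 0)) = b • L (c (t / max a 0))
  rw [map_smul]

/-- Rescalings compose multiplicatively (positive time factors). [folklore] -/
theorem rescale_rescale {a a' : ℝ} (ha : 0 < a) (ha' : 0 < a') (b b' : ℝ) (c : RootedCurve E) :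
    (c.rescale a' b').rescale a b = c.rescale (a * a') (b * b') := by
  refine RootedCurve.ext ?_ (funext fun t => ?_)
  · rw [rescale_dur ha.le, rescale_dur ha'.le, rescale_dur (mul_pos ha ha').le, mul_assoc]
  · show (c.rescale a' b').rescale a b t = c.rescale (a * a') (b * b') t
    rw [rescale_apply ha.le, rescale_apply ha'.le, rescale_apply (mul_pos ha ha').le, smul_smul,
      div_div]

/-- Dilations form a one-parameter group: `dilate ν a ∘ dilate ν a' = dilate ν (a a')`
(positive factors). [cite: LawlerSheffield2011, §1.2] -/
theorem dilate_dilate {ν a a' : ℝ} (ha : 0 < a) (ha' : 0 < a') (c : RootedCurve E) :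
    dilate ν a (dilate ν a' c) = dilate ν (a * a') c := by
  rw [dilate, dilate, dilate, rescale_rescale ha ha', Real.mul_rpow ha.le ha'.le]

/-- Rescaling the trivial curve gives the trivial curve. [folklore] -/
@[simp] theorem rescale_nil (a b : ℝ) : (nil : RootedCurve E).rescale a b = nil := by
  refine RootedCurve.ext (show max a 0 * (0 : ℝ) = 0 from mul_zero _) (funext fun t => ?_)
  show b • (nil : RootedCurve E) (t / max a 0) = 0
  rw [nil_apply, smul_zero]

/-- Dilating the trivial curve gives the trivial curve. [cite: LawlerSheffield2011, §1.2] -/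
@[simp] theorem dilate_nil (ν a : ℝ) : dilate ν a (nil : RootedCurve E) = nil :=
  rescale_nil _ _

/-! ### Lattice walks as naturally parametrised curves -/

/-- The **piecewise-linear curve through `x 0, x 1, …, x n` at unit speed in step units**: the
`k`-th step `[x k, x (k+1)]` is traversed affinely during `[k, k+1]`, the duration is `n`, and the
curve is translated to start at the root (`- x 0`). (Lawler–Sheffield 2011, §1.2: a lattice walk
`ω` becomes the path `ω̂ (j ε^d) = ω_j` "using linear interpolation"; here `ε^d = 1`, general
time-scales by `rescale`.) [cite: LawlerSheffield2011, §1.2] -/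
def ofWalk (n : ℕ) (x : ℕ → E) : RootedCurve E where
  dur := n
  toFun t := affineInterp ((List.range (n + 1)).map x) (max 0 (min t n)) -
    affineInterp ((List.range (n + 1)).map x) 0
  dur_nonneg := n.cast_nonneg
  continuous_toFun := ((continuous_affineInterp _).comp
    (continuous_const.max (continuous_id.min continuous_const))).sub continuous_const
  apply_of_nonpos t ht := by
    rw [min_eq_left (ht.trans n.cast_nonneg), max_eq_left ht, sub_self]
  apply_of_dur_le t ht := by
    rw [min_eq_right ht, min_self]

/-- `ofWalk n x` has duration `n`. [cite: LawlerSheffield2011, §1.2] -/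
@[simp] theorem ofWalk_dur (n : ℕ) (x : ℕ → E) : (ofWalk n x).dur = n := rfl

/-- At integer times `k ≤ n` the walk curve sits at `x k - x 0`. [cite: LawlerSheffield2011, §1.2] -/
theorem ofWalk_apply_natCast (n : ℕ) (x : ℕ → E) {k : ℕ} (hk : k ≤ n) :
    ofWalk n x k = x k - x 0 := by
  have hlen : k < ((List.range (n + 1)).map x).length := by simp; omega
  have h0 : 0 < ((List.range (n + 1)).map x).length := by simp
  change affineInterp _ (max 0 (min (k : ℝ) n)) - affineInterp _ 0 = _
  rw [min_eq_left (by exact_mod_cast hk), max_eq_right k.cast_nonneg, affineInterp_natCast _ k hlen,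
    show (0 : ℝ) = ((0 : ℕ) : ℝ) by simp, affineInterp_natCast _ 0 h0]
  simp

open Literature.Probability.LatticeModels in
/-- The `n`-step walk `ω` of `ℤ²`, drawn on `s ℤ² ⊆ ℂ` and traversed at one step per time `τ`
(duration `n τ`): `rescale τ s (ofWalk n (toComplex ∘ ω))`. With `s = ε`, `τ = ε^{1/ν}` this is
the embedding `ω̂ (j ε^d) = ε ω_j` of Lawler–Sheffield 2011, §1.2. [cite: LawlerSheffield2011, §1.2] -/
def sawCurve (s τ : ℝ) (n : ℕ) (ω : ℕ → Site 2) : RootedCurve ℂ :=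
  rescale τ s (ofWalk n fun i => Site.toComplex (ω i))

/-- The duration of an embedded walk is `n τ` (`τ ≥ 0`). [cite: LawlerSheffield2011, §1.2] -/
theorem sawCurve_dur {τ : ℝ} (hτ : 0 ≤ τ) (s : ℝ) (n : ℕ) (ω : ℕ → Literature.Probability.LatticeModels.Site 2) :
    (sawCurve s τ n ω).dur = n * τ := by
  rw [sawCurve, rescale_dur hτ, ofWalk_dur, mul_comm]

/-- The **uniform `n`-step SAW of `ℤ²` from `0` as a naturally parametrised curve**: the uniform
law `U_n` on `SAW.Zd.saws 2 n` pushed forward by `sawCurve s τ n` (mesh `s`, time `τ` per step).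
The dimerization identity `U_{M+N} = (U_M ⊗ U_N ∣ concatenation self-avoiding)` is
Madras–Slade 1993, Lemma 9.3.1. [cite: MadrasSlade1993, §9.3.2 Lemma 9.3.1] -/
def sawCurveLaw (s τ : ℝ) (n : ℕ) : Measure (RootedCurve ℂ) :=
  ((SAW.Zd.saws 2 n).card : ℝ≥0∞)⁻¹ • ∑ ω ∈ SAW.Zd.saws 2 n, Measure.dirac (sawCurve s τ n ω)

/-! ### The fusion map on laws -/

/-- The **uneven `ε`-regularised fusion map** `Ψ_{ν,t,ε}` (`t ∈ (0,1)`): fuse `(dilate ν t)_* P`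
with `(dilate ν (1-t))_* P`, so that durations `t T + (1-t) T = T` are preserved (posited by route
`SAWDimerizationRG`; lattice prototype Madras–Slade 1993, §9.3.2 with `N₁ = ⌊N/2⌋`, `N₂ = N - N₁`).
[cite: MadrasSlade1993, §9.3.2] -/
def fusionEps (ν t ε : ℝ) (P : Measure (RootedCurve E)) : Measure (RootedCurve E) :=
  pairFusion ε (P.map (dilate ν t)) (P.map (dilate ν (1 - t)))

/-- The **even `ε`-regularised fusion map** `Ψ_{ν,ε}`: fuse `P` with itself and dilate by time
factor `1/2` (space factor `2^{-ν}`), i.e. `(dilate ν 2⁻¹)_* (pairFusion ε P P)` (dimerization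
`N = N/2 + N/2`, Madras–Slade 1993, §9.3.2). [cite: MadrasSlade1993, §9.3.2] -/
def evenFusionEps (ν ε : ℝ) (P : Measure (RootedCurve E)) : Measure (RootedCurve E) :=
  (pairFusion ε P P).map (dilate ν 2⁻¹)

/-- **`Ψ_{ν,t}(P)` is defined and equals `Q`**: the conditioning events have positive mass for
every `ε > 0`, and the `ε`-regularised uneven fusions `fusionEps ν t ε P` converge weakly to `Q` as
`ε → 0⁺` (every bounded continuous test functional). Posited by route `SAWDimerizationRG`
(continuum limit of the dimerization identity, Madras–Slade 1993, Lemma 9.3.1). [cite: MadrasSlade1993, §9.3.2 Lemma 9.3.1] -/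
def HasFusionLaw (ν t : ℝ) (P Q : Measure (RootedCurve E)) : Prop :=
  (∀ ε : ℝ, 0 < ε → (P.map (dilate ν t)).prod (P.map (dilate ν (1 - t))) (nearlyDisjoint ε) ≠ 0) ∧
    ∀ f : RootedCurve E →ᵇ ℝ,
      Tendsto (fun ε => ∫ c, f c ∂(fusionEps ν t ε P)) (𝓝[>] 0) (𝓝 (∫ c, f c ∂Q))

/-- **Fusion fixed point with exponent `ν`**: for every split `t ∈ (0, 1)` the uneven fusion
`Ψ_{ν,t}(P)` is defined and equals `P` (posited by route `SAWDimerizationRG`: any scaling limit of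
the uniform SAW along all lengths, in its natural parametrisation, is a candidate, by
Madras–Slade 1993, Lemma 9.3.1). [cite: MadrasSlade1993, §9.3.2 Lemma 9.3.1] -/
def IsFusionFixedPoint (ν : ℝ) (P : Measure (RootedCurve E)) : Prop :=
  ∀ t ∈ Ioo (0 : ℝ) 1, HasFusionLaw ν t P P

/-- Along a fusion law of a probability measure, the `ε`-fusions are probability laws.
[cite: MadrasSlade1993, §9.3.2] -/
theorem HasFusionLaw.isProbabilityMeasure_fusionEps [SecondCountableTopology E] {ν t : ℝ}
    {P Q : Measure (RootedCurve E)} [IsProbabilityMeasure P] (h : HasFusionLaw ν t P Q) {ε : ℝ}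
    (hε : 0 < ε) : IsProbabilityMeasure (fusionEps ν t ε P) := by
  haveI := Measure.isProbabilityMeasure_map (μ := P) (measurable_dilate (E := E) ν t).aemeasurable
  haveI := Measure.isProbabilityMeasure_map (μ := P) (measurable_dilate (E := E) ν (1 - t)).aemeasurable
  exact isProbabilityMeasure_pairFusion (h.1 ε hε)

/-- A fusion law of a probability measure is a probability measure. [cite: MadrasSlade1993, §9.3.2] -/
theorem HasFusionLaw.isProbabilityMeasure [SecondCountableTopology E] {ν t : ℝ}
    {P Q : Measure (RootedCurve E)} [IsProbabilityMeasure P] (h : HasFusionLaw ν t P Q) :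
    IsProbabilityMeasure Q := by
  have h1 : Tendsto (fun ε => ∫ _c, (1 : ℝ) ∂(fusionEps ν t ε P)) (𝓝[>] 0) (𝓝 (∫ _c, (1 : ℝ) ∂Q)) :=
    h.2 (BoundedContinuousFunction.const _ 1)
  have h2 : Tendsto (fun ε => ∫ _c, (1 : ℝ) ∂(fusionEps ν t ε P)) (𝓝[>] 0) (𝓝 1) := by
    refine tendsto_const_nhds.congr' ?_
    filter_upwards [self_mem_nhdsWithin] with ε hε
    haveI := h.isProbabilityMeasure_fusionEps (Q := Q) hε
    simp
  have h3 : Q.real univ = 1 := by simpa using tendsto_nhds_unique h1 h2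
  exact isProbabilityMeasure_iff_real.2 h3

/-- **The fusion law is unique**: two fusion laws of the same `P` (same `ν`, `t`) coincide
(weak limits of finite Borel measures on a metric space are unique). [cite: MadrasSlade1993, §9.3.2] -/
theorem HasFusionLaw.unique {ν t : ℝ} {P Q Q' : Measure (RootedCurve E)} [IsFiniteMeasure Q]
    [IsFiniteMeasure Q'] (h : HasFusionLaw ν t P Q) (h' : HasFusionLaw ν t P Q') : Q = Q' :=
  ext_of_forall_integral_eq_of_IsFiniteMeasure fun f => tendsto_nhds_unique (h.2 f) (h'.2 f)

/-- A fusion fixed point (of a probability measure) has a unique fusion law at every split,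
namely itself. [cite: MadrasSlade1993, §9.3.2] -/
theorem IsFusionFixedPoint.eq_of_hasFusionLaw [SecondCountableTopology E] {ν : ℝ}
    {P Q : Measure (RootedCurve E)} [IsProbabilityMeasure P] (hP : IsFusionFixedPoint ν P) {t : ℝ}
    (ht : t ∈ Ioo (0 : ℝ) 1) (hQ : HasFusionLaw ν t P Q) : Q = P := by
  haveI := hQ.isProbabilityMeasure
  exact hQ.unique (hP t ht)

/-- The `ε`-fusions of the Dirac mass at the trivial curve are that Dirac mass. [folklore] -/
theorem fusionEps_dirac_nil [SecondCountableTopology E] (ν t ε : ℝ) :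
    fusionEps ν t ε (Measure.dirac (nil : RootedCurve E)) = Measure.dirac nil := by
  rw [fusionEps, Measure.map_dirac' (measurable_dilate ν t),
    Measure.map_dirac' (measurable_dilate ν (1 - t)), dilate_nil, dilate_nil, pairFusion_dirac_nil]

/-- **Degenerate fixed point.** The Dirac mass at the trivial curve `nil` is a fusion fixed
point for every exponent `ν` (so the definitions are not vacuous, and a rigidity statement about
fusion fixed points must add a non-degeneracy clause, as the route's `CanonicalLimit` does).
[folklore] -/
theorem isFusionFixedPoint_dirac_nil [SecondCountableTopology E] (ν : ℝ) :
    IsFusionFixedPoint ν (Measure.dirac (nil : RootedCurve E)) := by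
  intro t _
  refine ⟨fun ε _ => ?_, fun f => ?_⟩
  · rw [Measure.map_dirac' (measurable_dilate ν t), Measure.map_dirac' (measurable_dilate ν (1 - t)),
      dilate_nil, dilate_nil, Measure.dirac_prod_dirac,
      Measure.dirac_apply_of_mem (nil_mem_nearlyDisjoint ε)]
    exact one_ne_zero
  · simp only [fusionEps_dirac_nil]
    exact tendsto_const_nhds

end Space

end RootedCurve

end Literature.Probability.RandomPlanarGeometry
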